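import Mathlib
import Summits.NavierStokesRegularity.NavierStokesRegularity.Theses.LatticeTransitLiouville
import HarnessLib

/-!
# `LatticeTransitLiouville.Assembly` — the route's assembly (item stmt-NavierStokesRegularity-22150;
  pure logic)

**Statement.** `TransitExtraction → NoLatticeTransit → NoLoudLadderOne → EternalRigidityViscBddOne →
TaoLadderRungTwoBreak.Target`.

PROOF. The route file `Theses/LatticeTransitLiouville.lean` carries the planner-authored,
kernel-checked deciding theorem `Theses.LatticeTransitLiouville.closes`, whose hypotheses are
exactly the route's four cruxes and whose conclusion is the rung leaf `TaoLadderRungTwoBreak.Target`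
(TL-M2Break, D-0061); the assembly item is that implication written as ONE proposition, so it is
closed by applying `closes` to the hypotheses.

HONEST FRAMING: glue between the route's own statements about the `λ = 1` limit MODEL lattice of
Tao's cascade; nothing here is a statement about the Navier–Stokes equations, and the rung leaf is
not the summit Statement.
-/

noncomputable section

set_option linter.dupNamespace false

namespace Summit.NavierStokesRegularity.NavierStokesRegularity.Theorems

open Summit.NavierStokesRegularity.NavierStokesRegularity.Theses.LatticeTransitLiouville in
/-- **Item stmt-NavierStokesRegularity-22150** (`LatticeTransitLiouville.Assembly`): the route's four
cruxes imply its rung leaf `TaoLadderRungTwoBreak.Target`, by the route file's deciding theorem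
`closes`. [this file] -/
theorem latticeTransitLiouville_assembly_proof :
    Summit.NavierStokesRegularity.NavierStokesRegularity.Theses.LatticeTransitLiouville.Assembly := by
  unfold Summit.NavierStokesRegularity.NavierStokesRegularity.Theses.LatticeTransitLiouville.Assembly
  intro h₁ h₂ h₃ h₄
  exact closes h₁ h₂ h₃ h₄

end Summit.NavierStokesRegularity.NavierStokesRegularity.Theorems

end
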